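import Summits.ResolutionOfSingularities.ResolutionOfSingularities.Theorems.RadicialJungCleanModelsCriticalLocusClosedRegular
import Literature.AlgebraicGeometry.Resolution.ProjectiveSpaceRegular
import Mathlib.RingTheory.LocalProperties.Projective
import HarnessLib

/-!
# [OURS · L1 W8.1] `Ω[Γ(X,U)⁄ℤ]` IS PROJECTIVE on affine opens of a regular scheme locally of finite type over a field
# (cell res-hironaka, LADDER-RESOLUTION rung L; slot W8.1, RadicialJung `CleanModels` stmt-ResolutionOfSingularities-15917, T2 skeleton
# piece (S1a) of res-L0-w81-pv-2 g5's `S1-SPEC.md`; res-plan-2 IDLE POOL DEAL #65 (2); hand res-L1-type-o1 g11;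
# `--supports stmt-ResolutionOfSingularities-15917 --as helper`, counted 0)

OURS bookkeeping, 0 `def`s, every declaration PROVED; NOT a statement of H. Hironaka's manuscript [Hironaka2017]. AI-written, weaker
than expert review.

## What

* `projective_kaehler_int_of_isRegularRing` — RING LEVEL: for `A` of finite type over a field `k` of characteristic `p` with `A` regular
  (`IsRegularRing A`: every localisation at a prime is a regular local ring), the module of absolute Kähler differentials `Ω[A⁄ℤ]` is a
  PROJECTIVE `A`-module. Route (S1-SPEC (S1a), the pattern of `exists_free_kaehler_localization_away`, p548422): by p547815
  `exists_linearEquiv_kaehler_prod_finsupp_of_finiteType ℤ k A`, `Ω[A⁄ℤ] ≃ M₀ × (ι →₀ A)` with `M₀` finitely presented; at every maximal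
  `𝔮`, `(M₀)_𝔮` is a direct summand of `Ω[A_𝔮⁄ℤ]`, which is projective because `A_𝔮` — regular, essentially of finite type over `k` — is
  formally smooth over `𝔽_p` (`formallySmooth_zmod_of_isRegularLocalRing_of_essFiniteType`, `projective_kaehler_int_of_zmod`); so `M₀` is
  locally projective, hence projective (`Module.projective_of_localization_maximal`), and `Ω[A⁄ℤ]` is projective as a product of a
  projective and a free module.
* `projective_localizedModule_of_isRegularRing` — the local step isolated: `(M₀)_𝔮` is projective over `A_𝔮` for every summand
  decomposition `Ω[A⁄ℤ] ≃ M₀ × N`.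
* **`projective_kaehler_sections_of_isAffineOpen`** — SCHEME LEVEL, the `hproj` binder of res-L1-s42-pv-2's FILE 5
  `finite_setOf_giraudColength_ne_zero_of_chart` / `finite_setOf_isGiraudSingularPoint_of_charts` (p563225) VERBATIM: for `X` regular,
  locally Noetherian, `q : X ⟶ Spec k` locally of finite type, `CharP k p`, and `U` an affine open, `Module.Projective Γ(X, U) Ω[Γ(X, U)⁄ℤ]`
  (the chart ring is of finite type over `k` through `q.appLE`, regular by `Scheme.IsRegular.isRegularRing_of_isAffineOpen`; the two
  `ℤ`-algebra structures are identified by `projective_kaehler_int_congr`).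

VACUITY. Not vacuous: the hypotheses are met by every chart of the T2 skeleton's surface `X`; the conclusion fails for non-regular `A`
(e.g. `k[x,y]/(xy)` at the node), so `IsRegularRing` carries weight.

References (context): J. Giraud, Bull. SMF 111 (1983), 1.1 [Giraud1983]; Stacks Project Tags 031I, 07PE, 00NX [StacksProject].
-/

noncomputable section

set_option linter.dupNamespace false -- mandated namespace of this single-conjunct summit

open KaehlerDifferential Module IsLocalRing
open CategoryTheory AlgebraicGeometry
open Literature.AlgebraicGeometry.Resolution

namespace Summit.ResolutionOfSingularities.ResolutionOfSingularities.Theorems.RadicialJung.CleanModels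

/-! ## Ring level -/

section Ring

variable (p : ℕ) [Fact p.Prime] (k A : Type) [Field k] [CharP k p] [CommRing A] [Algebra k A] [Algebra.FiniteType k A]
  [IsRegularRing A]

include p k

/-- **`Ω[A_𝔮⁄ℤ]` is projective at every prime of a regular algebra of finite type over a field of characteristic `p`** (the local
ring is regular and essentially of finite type over `k`, hence formally smooth over `𝔽_p`). [cite: StacksProject, Tag 07PE, Tag 031I] -/
theorem projective_kaehler_localization_atPrime_of_isRegularRing (P : Ideal A) [P.IsPrime] :
    Module.Projective (Localization.AtPrime P) Ω[Localization.AtPrime P⁄ℤ] := by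
  let L := Localization.AtPrime P
  haveI : CharP L p := charP_of_injective_algebraMap (algebraMap k L).injective p
  letI : Algebra (ZMod p) L := ZMod.algebra L p
  haveI := formallySmooth_zmod_of_isRegularLocalRing_of_essFiniteType p k L
  exact projective_kaehler_int_congr _ _ (projective_kaehler_int_of_zmod p (O := L))

/-- **The local step**: for any decomposition `Ω[A⁄ℤ] ≃ M₀ × N`, the localisation `(M₀)_𝔮` at a prime `𝔮` is a direct summand of the
projective `Ω[A_𝔮⁄ℤ]`, hence projective (verbatim the split of `exists_free_kaehler_localization_away`). [cite: StacksProject, Tag 00NX] -/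
theorem projective_localizedModule_of_isRegularRing {M₀ N : Type} [AddCommGroup M₀] [Module A M₀] [AddCommGroup N] [Module A N]
    (e : Ω[A⁄ℤ] ≃ₗ[A] M₀ × N) (P : Ideal A) [P.IsPrime] :
    Module.Projective (Localization.AtPrime P) (LocalizedModule P.primeCompl M₀) := by
  haveI := projective_kaehler_localization_atPrime_of_isRegularRing p k A P
  let L := Localization.AtPrime P
  let S := P.primeCompl
  let g₀ := LocalizedModule.mkLinearMap S M₀
  let i₀ : M₀ →ₗ[A] Ω[L⁄ℤ] := map ℤ ℤ A L ∘ₗ (e.symm : M₀ × N →ₗ[A] Ω[A⁄ℤ]) ∘ₗ LinearMap.inl A M₀ N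
  have hu₁ : ∀ x : S, IsUnit (algebraMap A (Module.End A Ω[L⁄ℤ]) x) :=
    fun x => IsLocalizedModule.map_units (map ℤ ℤ A L) x
  have hu₂ : ∀ x : S, IsUnit (algebraMap A (Module.End A (LocalizedModule S M₀)) x) :=
    fun x => IsLocalizedModule.map_units g₀ x
  let i : LocalizedModule S M₀ →ₗ[A] Ω[L⁄ℤ] := IsLocalizedModule.lift S g₀ i₀ hu₁
  have hi : ∀ m, i (g₀ m) = i₀ m := fun m => LinearMap.congr_fun (IsLocalizedModule.lift_comp S g₀ i₀ hu₁) m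
  let r₀ : Ω[A⁄ℤ] →ₗ[A] LocalizedModule S M₀ := g₀ ∘ₗ LinearMap.fst A M₀ N ∘ₗ (e : Ω[A⁄ℤ] →ₗ[A] M₀ × N)
  let r : Ω[L⁄ℤ] →ₗ[A] LocalizedModule S M₀ := IsLocalizedModule.lift S (map ℤ ℤ A L) r₀ hu₂
  have hr : ∀ ω, r (map ℤ ℤ A L ω) = r₀ ω := fun ω => LinearMap.congr_fun (IsLocalizedModule.lift_comp S (map ℤ ℤ A L) r₀ hu₂) ω
  have hri : r ∘ₗ i = LinearMap.id := by
    refine IsLocalizedModule.linearMap_ext S g₀ g₀ ?_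
    ext m
    simp only [LinearMap.comp_apply, LinearMap.id_comp, hi, i₀, hr, r₀, LinearEquiv.coe_coe, LinearMap.inl_apply,
      LinearEquiv.apply_symm_apply, LinearMap.fst_apply]
  exact Module.Projective.of_split (i.extendScalarsOfIsLocalization S L) (r.extendScalarsOfIsLocalization S L) (by
    ext x
    have := LinearMap.congr_fun hri x
    simpa using this)

/-- [OURS · L1 W8.1] **`Ω[A⁄ℤ]` IS PROJECTIVE for `A` regular of finite type over a field of characteristic `p`** (S1-SPEC (S1a), ring
level): `Ω[A⁄ℤ] ≃ M₀ × (ι →₀ A)` with `M₀` finitely presented (p547815) and locally projective (previous lemma), so projective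
(`Module.projective_of_localization_maximal`). NOT a statement of the manuscript. [cite: StacksProject, Tag 00NX, Tag 07PE] -/
theorem projective_kaehler_int_of_isRegularRing : Module.Projective A Ω[A⁄ℤ] := by
  classical
  obtain ⟨M₀, _, _, _, ι, ⟨e⟩⟩ := exists_linearEquiv_kaehler_prod_finsupp_of_finiteType ℤ k A
  haveI : Module.Projective A M₀ :=
    Module.projective_of_localization_maximal fun P hP => by
      haveI := hP.isPrime
      exact projective_localizedModule_of_isRegularRing p k A e P
  exact Module.Projective.of_equiv e.symm

end Ring

/-! ## Scheme level: affine opens of a regular scheme locally of finite type over `k` -/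

/-- [OURS · L1 W8.1] **(S1a) `Ω[Γ(X,U)⁄ℤ]` IS PROJECTIVE ON AFFINE OPENS** — the `hproj` binder of res-L1-s42-pv-2's FILE 5
(`finite_setOf_isGiraudSingularPoint_of_charts`, p563225): for `X` regular and locally Noetherian, `q : X ⟶ Spec k` locally of finite type
over a field `k` of characteristic `p`, and `U` an affine open, `Module.Projective Γ(X, U) Ω[Γ(X, U)⁄ℤ]`. NOT a statement of the manuscript.
[cite: Giraud1983, 1.1] [cite: StacksProject, Tag 07PE] -/
theorem projective_kaehler_sections_of_isAffineOpen (p : ℕ) [Fact p.Prime] (k : Type) [Field k] [CharP k p] {X : Scheme.{0}}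
    [IsLocallyNoetherian X] (q : X ⟶ Spec (.of k)) [LocallyOfFiniteType q] (hX : Scheme.IsRegular X) {U : X.Opens}
    (hU : IsAffineOpen U) : Module.Projective Γ(X, U) Ω[Γ(X, U)⁄ℤ] := by
  -- the chart ring: of finite type over `k`, regular
  let φ : CommRingCat.of k ⟶ Γ(X, U) := (Scheme.ΓSpecIso (.of k)).inv ≫ q.appLE ⊤ U le_top
  letI : Algebra k Γ(X, U) := φ.hom.toAlgebra
  haveI : Algebra.FiniteType k Γ(X, U) := by
    have h1 : RingHom.FiniteType (q.appLE ⊤ U le_top).hom :=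
      HasRingHomProperty.appLE @LocallyOfFiniteType q ‹_› ⟨⊤, isAffineOpen_top _⟩ ⟨U, hU⟩ le_top
    have h2 : RingHom.FiniteType φ.hom := by
      rw [CommRingCat.hom_comp]
      exact h1.comp (RingHom.FiniteType.of_surjective _ (Scheme.ΓSpecIso (.of k)).commRingCatIsoToRingEquiv.symm.surjective)
    exact h2
  haveI : IsRegularRing Γ(X, U) := hX.isRegularRing_of_isAffineOpen hU
  exact projective_kaehler_int_congr _ _ (projective_kaehler_int_of_isRegularRing p k Γ(X, U))

end Summit.ResolutionOfSingularities.ResolutionOfSingularities.Theorems.RadicialJung.CleanModels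

end
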